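import Summits.PneNP.PneNP.Theorems.ChebyshevTracialDesignRectangleTruncation
import Summits.PneNP.PneNP.Theorems.ChebyshevTracialDesignLevelNormalisation
import Summits.PneNP.PneNP.Theorems.ChebyshevTracialDesignLevelDominanceSharp
import HarnessLib

/-!
# Cell pnp-psdrank, route `ChebyshevTracialDesign`: the level profile of every weighted rectangle is a polynomial of degree `≤ D`
# at EVERY odd level, up to `√(P_D · μ · ν)`; its value at the virtual level `0` is Grigoriev's pseudo-expectation

Harmonic backbone of the crux `TracialDecayExp20` (stmt-PneNP-19878), brick 18 (prover g7). Let `n` be even, `t = 2c'+1` with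
`2t + 2 ≤ n`, `D < t`, `f` a function on the `t`-cuts with a harmonic layer decomposition `f = Σ_j (Wᵀ)^{t−j} p_j` (lit
`exists_ladder_decomposition`; `q = Σ_{j ≤ D} (t−j)!·p_j` is the coefficient vector of its low part `f_{≤D} = zeta q`) and
`y : PM_n → ℝ` ANY weights on the perfect matchings. The WEIGHTED LEVEL PROFILE of `f ⊗ y` is
`L_c(f, y) := Σ_M y(M) · Σ_{|U| = t, cc(U,M) = c} f(U)` (for `f = 1_X`, `y = 1_Y` this is `|(X × Y) ∩ Q_c(t)|`). THEN THERE IS ONE REAL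
POLYNOMIAL `P` OF DEGREE `≤ D` WITH

  `P(0) = (1/|PM_n|) · Σ_M y(M) · Ẽ_M[f_{≤D}]`          (`Ẽ_M[zeta q] = Σ_{|A| ≤ D} q_A · knapsackMoment(|M|, t/2, |M[A]|)`, Grigoriev's
                                                          knapsack pseudo-expectation around `M`, bricks G/H of the junta files), and
  `|L_c(f, y) − |Q_c(t)| · P(c)| ≤ |Q_c(t)| · √(P_D · (‖f‖²/C(n,t)) · (‖y‖²/|PM_n|))`   for EVERY odd level `c = 2m+1 ≤ t`,

where `P_D = Π_{i ≤ D/2} (2i+1)/(n−2i)` (`≈ n^{−3D/8}` for `D = dq n`) — `weighted_profile_polynomial`. In words: at precision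
`√(P_D μ ν)` the level profile of a (weighted) rectangle IS a degree-`D` polynomial in the level, at all `≈ t/2` odd levels and not only at
the `|C| ≤ D+1` design nodes, and the analytic continuation of that polynomial to the parity-forbidden level `c = 0` is the averaged
virtual value. Consequences recorded here:
* `rectangle_profile_polynomial` — the `0/1` case: for every rectangle `X × Y` the level counts `|(X × Y) ∩ Q_c|` are
  `|Q_c|·(P(c) ± √(P_D μ(X) ν(Y)))` at every odd level, `P(0) = (1/|PM|)·Σ_{M∈Y} Ẽ_M[(1_X)_{≤D}]`;
* `weighted_value_truncation_explicit` / `rectangle_value_truncation_explicit` — the EXPLICIT-TAIL form of the r = 1 degree-truncation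
  theorem (brick 16, `…RectangleTruncation.rectangle_value_truncation`): for an exact design of degree `D` (levels `C`, weights `w`,
  `Σ|w_c| ≤ B`), `|V(f ⊗ y) + P(0)| ≤ B · √(P_D · ‖f‖²/C(n,t) · ‖y‖²/|PM|)`, in particular
  `|V(X × Y) + (1/|PM|)·Σ_{M∈Y} Ẽ_M[(1_X)_{≤D}]| ≤ B·√(P_D · μ(X) · ν(Y))` — design-INDEPENDENT up to the tail: the r = 1 shadow of the
  crux is the statement `P(0) ≥ −e^{−a·dq n}` about the profile polynomial of tight rectangles.
Inputs: eng g8's sharp attenuation `…LevelDominanceSharp.kernelEigen_level_le_sharp` (packaged beyond a truncation degree as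
`kernelEigen_level_le_of_lt_sharp`, the `(1+ρ)`-free form of brick 13), lit's `JohnsonSpectrum.sum_sq_gram_highPart_le`, the junta files'
`containment_comb_poly`, and brick 17's normalisations `card_Qset_eq` / `kernelEigen_level_zero_eq` (`λ₀(c)·C(n,t)·|PM| = |Q_c|²`).
[cite: Rothvoss2017, §2 (PDF p. 6)] [cite: Grigoriev2001, Lemma 1.4 (PDF p. 8)] [cite: BrouwerHaemers2012, Prop. 4.3.2 (PDF p. 83)]
Stature: support/instrument. WHAT THIS IS NOT: not virtual positivity (the sign of `P(0)` for tight rectangles is the open heart of the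
crux), nothing on psd rank, no P-vs-NP content. Supports stmt-PneNP-19878.
-/

set_option linter.dupNamespace false -- `Summit.PneNP.PneNP.…`: summit = sub-problem (D-0017)

noncomputable section

namespace Summit.PneNP.PneNP.Theorems.ChebyshevTracialDesignProfilePolynomial

open Finset Polynomial Literature.Barriers.PneNP Literature.Combinatorics.Optimization Literature.Computability.Complexity
open Literature.Combinatorics.SimpleGraph.CycleSpace
open Literature.Combinatorics.AssociationSchemes Literature.Combinatorics.AssociationSchemes.JohnsonHarmonics
open Literature.Combinatorics.AssociationSchemes.JohnsonSpectrum
open Summit.PneNP.PneNP.Theorems.ChebyshevTracialDesignJunta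
open Summit.PneNP.PneNP.Theorems.ChebyshevTracialDesignTightColumnSums
open Summit.PneNP.PneNP.Theorems.ChebyshevTracialDesignTightFreeSpectral
open Summit.PneNP.PneNP.Theorems.ChebyshevTracialDesignLowDegreePricing
open Summit.PneNP.PneNP.Theorems.ChebyshevTracialDesignHighPartTail
open Summit.PneNP.PneNP.Theorems.ChebyshevTracialDesignLevelAttenuation
open Summit.PneNP.PneNP.Theorems.ChebyshevTracialDesignLevelTail
open Summit.PneNP.PneNP.Theorems.ChebyshevTracialDesignLevelNormalisation
open Summit.PneNP.PneNP.Theorems.ChebyshevTracialDesignLevelDominanceSharp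

variable {n : ℕ}

/-! ### §1 The deep spectrum of every level kernel beyond a truncation degree, with the tight-level constant -/

/-- **The deep spectrum beyond a truncation degree, sharp form** (eng g8's `kernelEigen_level_le_sharp` packaged as the `hΛ`
hypothesis of lit's `sum_sq_gram_highPart_le`; the `(1+ρ)`-free form of brick 13's `kernelEigen_level_le_of_lt_uncond`): for `n`
even, `t = 2c+1` with `2t + 2 ≤ n`, `m ≤ c`, any Gram class function `κ_m` of the level-`(2m+1)` incidence on the `t`-sets and every
layer `K < j ≤ t`: `kernelEigen n t j κ_m ≤ kernelEigen n t 0 κ_m · Π_{i < K/2+1} (2i+1)/(n−2i)`.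
[cite: Rothvoss2017, §2 (PDF p. 6)] [cite: BrouwerHaemers2012, Prop. 4.3.2 (PDF p. 83)] -/
theorem kernelEigen_level_le_of_lt_sharp {c m K : ℕ} (hn : Even n) (ht : 2 * (2 * c + 1) + 2 ≤ n) (hmc : m ≤ c)
    (κm : ℕ → ℝ)
    (hAm : ∀ U ∈ univ.powersetCard (2 * c + 1), ∀ U' ∈ univ.powersetCard (2 * c + 1),
      ∑ M : PMatch n, (if (U.filter fun x => M.2.partner x ∉ U).card = 2 * m + 1 then (1 : ℝ) else 0) *
        (if (U'.filter fun x => M.2.partner x ∉ U').card = 2 * m + 1 then (1 : ℝ) else 0) = κm (U ∩ U').card)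
    {j : ℕ} (hKj : K < j) (hjt : j ≤ 2 * c + 1) :
    kernelEigen n (2 * c + 1) j κm ≤
      kernelEigen n (2 * c + 1) 0 κm * ∏ i ∈ range (K / 2 + 1), ((2 * i + 1 : ℝ) / ((n : ℝ) - 2 * i)) := by
  have ht' : 2 * (2 * c + 1) ≤ n := by omega
  have hl0 := kernelEigen_level_zero_nonneg ht' κm hAm
  obtain ⟨κ₁, hA1⟩ := exists_tightGram_classFunction (n := n) (t := 2 * c + 1) ⟨c, rfl⟩
  rcases Nat.even_or_odd j with ⟨κ', hκ'⟩ | hodd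
  · -- even layer `j = 2κ'` with `K/2 + 1 ≤ κ' ≤ c`
    have hj : j = 2 * κ' := by omega
    have hκc : κ' ≤ c := by omega
    have hKκ : K / 2 + 1 ≤ κ' := by omega
    rw [hj]
    refine (kernelEigen_level_le_sharp hn ht hκc hmc κ₁ κm hA1 hAm).trans ?_
    exact mul_le_mul_of_nonneg_left (prod_atten_le_of_le (n := n) hKκ (by omega)) hl0
  · -- odd layers vanish
    rw [kernelEigen_level_eq_zero_of_odd ht' hmc hjt hodd κm hAm]
    exact mul_nonneg hl0 (prod_nonneg fun i hi => (atten_factor_le_one (by have := mem_range.1 hi; omega)).1)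

/-! ### §2 The low part: every matching prices a low-degree test function by ONE polynomial of the level -/

/-- **Per-matching level polynomial of a low-degree test function** (junta bricks G/H in incidence form): for `t` odd, a perfect
matching `M` and a coefficient vector `q` supported on sets of size `≤ D`, there is a real polynomial `P_M` of degree `≤ D` with
`P_M(0) = Ẽ_M[zeta q] = Σ_{|A| ≤ D} q_A · knapsackMoment(|M|, t/2, |M[A]|)` and, for every splitting `c + 2i = t`,
`Σ_{|U| = t} zeta q (U) · 1[#cr(U,M) = c] = T(n/2; c, i) · P_M(c)`, `T(n/2; c, i) = C(n/2, c+i)·C(c+i, i)·2^c`.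
[cite: Grigoriev2001, Lemma 1.4 (PDF p. 8)] [cite: Rothvoss2017, §2 (PDF p. 6)] -/
theorem exists_levelPoly_zeta {t D : ℕ} (ht : Odd t) (M : PMatch n) (q : Finset (Fin n) → ℝ)
    (hq : ∀ A : Finset (Fin n), D < A.card → q A = 0) :
    ∃ P : Polynomial ℝ, P.natDegree ≤ D ∧
      P.eval 0 = ∑ A : {A : Finset (Fin n) // A.card ≤ D},
        q A.1 * knapsackMoment M.1.card ((t : ℝ) / 2) (M.1.filter fun e => ∃ a ∈ A.1, a ∈ e).card ∧
      ∀ c i : ℕ, c + 2 * i = t →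
        ∑ U ∈ univ.powersetCard t, zeta q U * (if (U.filter fun x => M.2.partner x ∉ U).card = c then (1 : ℝ) else 0) =
          (((n / 2).choose (c + i) * (c + i).choose i * 2 ^ c : ℕ) : ℝ) * P.eval (c : ℝ) := by
  classical
  have hN : M.1.card = n / 2 := by have := two_mul_card_pmatch M; omega
  obtain ⟨P, hPdeg, hP0, hPval⟩ := containment_comb_poly M t D
    (σ := {A : Finset (Fin n) // A.card ≤ D}) (fun A => q A.1) (fun A => A.1)
    (fun A => by
      have h1 : (M.1.filter fun e => ∃ a ∈ A.1, a ∈ e).card ≤ A.1.card := by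
        convert card_filter_meets_le M.2 A.1 using 3
      exact h1.trans A.2)
  refine ⟨P, hPdeg, hP0, fun c i hci => ?_⟩
  have key := sum_oddSet_level_eq M hci (r := 1) (fun U => zeta q U.1 • (1 : Matrix (Fin 1) (Fin 1) ℝ)) (fun _ => 1)
  simp only [Matrix.trace_smul, Matrix.trace_one, Fintype.card_fin, Nat.cast_one, smul_eq_mul, mul_one] at key
  rw [← sum_oddSet_level_eq_colSum ht M c (zeta q), key, ← hN, ← hPval c i hci]
  refine sum_congr rfl fun U' hU' => ?_
  have hodd : Odd U'.card := by
    obtain ⟨-, hc, hi⟩ := mem_filter.1 hU'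
    have h := card_eq_cr_add_two_mul_in M.2 (subset_univ U')
    rw [hc, hi, hci] at h
    exact h ▸ ht
  rw [dif_pos hodd, zeta_eq_sum_subtype q hq U']

/-- **Weighted level polynomial**: for `t` odd, weights `y : PM_n → ℝ` and `q` supported on sets of size `≤ D`, there is ONE real
polynomial `P` of degree `≤ D` with `P(0) = Σ_M y(M) · Ẽ_M[zeta q]` and
`Σ_M y(M) · Σ_{|U|=t} zeta q (U) · 1[#cr(U,M) = c] = T(n/2; c, i) · P(c)` for every `c + 2i = t`.
[cite: Grigoriev2001, Lemma 1.4 (PDF p. 8)] [cite: Rothvoss2017, §2 (PDF p. 6)] -/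
theorem exists_weighted_levelPoly_zeta {t D : ℕ} (ht : Odd t) (y : PMatch n → ℝ) (q : Finset (Fin n) → ℝ)
    (hq : ∀ A : Finset (Fin n), D < A.card → q A = 0) :
    ∃ P : Polynomial ℝ, P.natDegree ≤ D ∧
      P.eval 0 = ∑ M : PMatch n, y M * ∑ A : {A : Finset (Fin n) // A.card ≤ D},
        q A.1 * knapsackMoment M.1.card ((t : ℝ) / 2) (M.1.filter fun e => ∃ a ∈ A.1, a ∈ e).card ∧
      ∀ c i : ℕ, c + 2 * i = t →
        ∑ M : PMatch n, y M * ∑ U ∈ univ.powersetCard t,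
            zeta q U * (if (U.filter fun x => M.2.partner x ∉ U).card = c then (1 : ℝ) else 0) =
          (((n / 2).choose (c + i) * (c + i).choose i * 2 ^ c : ℕ) : ℝ) * P.eval (c : ℝ) := by
  classical
  have hP := fun M : PMatch n => exists_levelPoly_zeta (D := D) ht M q hq
  choose P hPdeg hP0 hPval using hP
  refine ⟨∑ M : PMatch n, C (y M) * P M, ?_, ?_, ?_⟩
  · exact natDegree_sum_le_of_forall_le _ _ fun M _ => (natDegree_C_mul_le _ _).trans (hPdeg M)
  · rw [eval_finsetSum]
    exact sum_congr rfl fun M _ => by rw [eval_mul, eval_C, hP0 M]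
  · intro c i hci
    rw [eval_finsetSum, mul_sum]
    refine sum_congr rfl fun M _ => ?_
    rw [hPval M c i hci, eval_mul, eval_C]
    ring

/-! ### §3 The high part: weighted Cauchy–Schwarz against the deep spectrum -/

/-- **Weighted high-part bound at one level**: for `2t ≤ n+1`, a ladder decomposition `Σ_j (Wᵀ)^{t−j} p_j`, a truncation degree `K`,
the level-`c` incidence with Gram class function `κ` and a bound `Λ ≥ 0` on its layers `K < j ≤ t`, and any weights `y`:
`|Σ_M y(M) · Σ_{|U|=t} f_{>K}(U) · 1[#cr(U,M) = c]| ≤ √(Λ · ‖y‖² · Σ_{|U|=t} f(U)²)`.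
[cite: BrouwerHaemers2012, Prop. 4.3.2 (PDF p. 83)] -/
theorem highPart_weighted_level_le {t K : ℕ} (htn : 2 * t ≤ n + 1) (c : ℕ) (p : ℕ → Finset (Fin n) → ℝ)
    (hp : ∀ j, IsHarmonic j (p j)) (κ : ℕ → ℝ)
    (hA : ∀ U ∈ univ.powersetCard t, ∀ U' ∈ univ.powersetCard t,
      ∑ M : PMatch n, (if (U.filter fun x => M.2.partner x ∉ U).card = c then (1 : ℝ) else 0) *
        (if (U'.filter fun x => M.2.partner x ∉ U').card = c then (1 : ℝ) else 0) = κ (U ∩ U').card)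
    {Λ : ℝ} (hΛ0 : 0 ≤ Λ) (hΛ : ∀ j, K < j → j ≤ t → kernelEigen n t j κ ≤ Λ) (y : PMatch n → ℝ) :
    |∑ M : PMatch n, y M * ∑ U ∈ univ.powersetCard t,
        (∑ j ∈ range (t + 1), up^[t - j] (if K < j then p j else 0)) U *
          (if (U.filter fun x => M.2.partner x ∉ U).card = c then (1 : ℝ) else 0)| ≤
      Real.sqrt (Λ * ((∑ M : PMatch n, y M ^ 2) *
        ∑ U ∈ univ.powersetCard t, (∑ j ∈ range (t + 1), up^[t - j] (p j)) U ^ 2)) := by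
  classical
  set h : PMatch n → ℝ := fun M => ∑ U ∈ univ.powersetCard t,
    (∑ j ∈ range (t + 1), up^[t - j] (if K < j then p j else 0)) U *
      (if (U.filter fun x => M.2.partner x ∉ U).card = c then (1 : ℝ) else 0) with hh
  refine Real.abs_le_sqrt ?_
  have hCS := sum_mul_sq_le_sq_mul_sq (univ : Finset (PMatch n)) y h
  have hgram := sum_sq_gram_highPart_le htn K
    (fun U (M : PMatch n) => if (U.filter fun x => M.2.partner x ∉ U).card = c then (1 : ℝ) else 0) κ hA p hp hΛ0 hΛ
  calc (∑ M : PMatch n, y M * h M) ^ 2 ≤ (∑ M : PMatch n, y M ^ 2) * ∑ M : PMatch n, h M ^ 2 := hCS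
    _ ≤ (∑ M : PMatch n, y M ^ 2) *
        (Λ * ∑ U ∈ univ.powersetCard t, (∑ j ∈ range (t + 1), up^[t - j] (p j)) U ^ 2) :=
        mul_le_mul_of_nonneg_left (by rw [hh]; exact hgram) (sum_nonneg fun M _ => sq_nonneg _)
    _ = _ := by ring

/-! ### §4 Low + high at one level: the weighted level sum is `T(n/2;c,i)·P(c)` up to the spectral tail -/

/-- **One level of a weighted rectangle, truncated**: with `f = Σ_j (Wᵀ)^{t−j} p_j` on the `t`-sets (`t` odd, `2t ≤ n+1`), `P` the
weighted level polynomial of its low part `f_{≤K}` (§2) and `Λ` a bound on the deep layers `K < j ≤ t` of the level-`c` kernel: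
`|Σ_M y(M)·Σ_{|U|=t} f(U)·1[#cr(U,M) = c] − T(n/2; c, i)·P(c)| ≤ √(Λ·‖y‖²·‖f‖²)` for `c + 2i = t`.
[cite: Rothvoss2017, §2 (PDF p. 6)] [cite: BrouwerHaemers2012, Prop. 4.3.2 (PDF p. 83)] -/
theorem weighted_level_sum_sub_poly_le {t K : ℕ} (htn : 2 * t ≤ n + 1) (y : PMatch n → ℝ)
    (f : Finset (Fin n) → ℝ) (p : ℕ → Finset (Fin n) → ℝ) (hp : ∀ j, IsHarmonic j (p j))
    (hdec : ∀ U ∈ univ.powersetCard t, f U = (∑ j ∈ range (t + 1), up^[t - j] (p j)) U)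
    (P : Polynomial ℝ)
    (hP : ∀ c i : ℕ, c + 2 * i = t →
      ∑ M : PMatch n, y M * ∑ U ∈ univ.powersetCard t,
          zeta (∑ j ∈ range (t + 1), ((t - j).factorial : ℝ) • (if K < j then 0 else p j)) U *
            (if (U.filter fun x => M.2.partner x ∉ U).card = c then (1 : ℝ) else 0) =
        (((n / 2).choose (c + i) * (c + i).choose i * 2 ^ c : ℕ) : ℝ) * P.eval (c : ℝ))
    {c i : ℕ} (hci : c + 2 * i = t) (κ : ℕ → ℝ)
    (hA : ∀ U ∈ univ.powersetCard t, ∀ U' ∈ univ.powersetCard t,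
      ∑ M : PMatch n, (if (U.filter fun x => M.2.partner x ∉ U).card = c then (1 : ℝ) else 0) *
        (if (U'.filter fun x => M.2.partner x ∉ U').card = c then (1 : ℝ) else 0) = κ (U ∩ U').card)
    {Λ : ℝ} (hΛ0 : 0 ≤ Λ) (hΛ : ∀ j, K < j → j ≤ t → kernelEigen n t j κ ≤ Λ) :
    |∑ M : PMatch n, y M * ∑ U ∈ univ.powersetCard t,
          f U * (if (U.filter fun x => M.2.partner x ∉ U).card = c then (1 : ℝ) else 0) -
        (((n / 2).choose (c + i) * (c + i).choose i * 2 ^ c : ℕ) : ℝ) * P.eval (c : ℝ)| ≤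
      Real.sqrt (Λ * ((∑ M : PMatch n, y M ^ 2) * ∑ U ∈ univ.powersetCard t, f U ^ 2)) := by
  classical
  set q : Finset (Fin n) → ℝ := ∑ j ∈ range (t + 1), ((t - j).factorial : ℝ) • (if K < j then 0 else p j) with hq
  -- split `f = f_{≤K} + f_{>K}` on the `t`-sets
  have hsplit : ∀ U ∈ univ.powersetCard t, f U =
      zeta q U + (∑ j ∈ range (t + 1), up^[t - j] (if K < j then p j else 0)) U := by
    intro U hU
    rw [hdec U hU, ladderSum_eq_low_add_high K p, Pi.add_apply, (lowPart_apply_eq_zeta K p hp (mem_powersetCard.1 hU).2).1]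
  have hsum : ∑ M : PMatch n, y M * ∑ U ∈ univ.powersetCard t,
        f U * (if (U.filter fun x => M.2.partner x ∉ U).card = c then (1 : ℝ) else 0) =
      ∑ M : PMatch n, y M * ∑ U ∈ univ.powersetCard t,
          zeta q U * (if (U.filter fun x => M.2.partner x ∉ U).card = c then (1 : ℝ) else 0) +
        ∑ M : PMatch n, y M * ∑ U ∈ univ.powersetCard t,
          (∑ j ∈ range (t + 1), up^[t - j] (if K < j then p j else 0)) U *
            (if (U.filter fun x => M.2.partner x ∉ U).card = c then (1 : ℝ) else 0) := by
    rw [← sum_add_distrib]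
    refine sum_congr rfl fun M _ => ?_
    rw [← mul_add, ← sum_add_distrib]
    congr 1
    exact sum_congr rfl fun U hU => by rw [hsplit U hU]; ring
  have hnorm : ∑ U ∈ univ.powersetCard t, (∑ j ∈ range (t + 1), up^[t - j] (p j)) U ^ 2 =
      ∑ U ∈ univ.powersetCard t, f U ^ 2 := sum_congr rfl fun U hU => by rw [hdec U hU]
  rw [hsum, hP c i hci, add_sub_cancel_left, ← hnorm]
  exact highPart_weighted_level_le htn c p hp κ hA hΛ0 hΛ y

/-! ### §5 Normalisations: `|PM_n| > 0`, `|Q_c| = |PM|·N_c`, `λ₀(c)·C(n,t)·|PM| = |Q_c|²`, and the tail in `μν` form -/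

/-- For `n` even there is a perfect matching of `K_n`, so `|PM_n| > 0`. [folklore] -/
theorem card_pmatch_pos (hn : Even n) : 0 < Fintype.card (PMatch n) :=
  Fintype.card_pos_iff.2 ⟨⟨pairMatching n, isPMOn_pairMatching (Nat.even_iff.1 hn)⟩⟩

/-- The attenuation product `P_K = Π_{i < K/2+1} (2i+1)/(n−2i)` is nonnegative when `2K + 1 ≤ n`. -/
theorem prod_atten_nonneg {K : ℕ} (hK : 2 * K + 1 ≤ n) :
    0 ≤ ∏ i ∈ range (K / 2 + 1), ((2 * i + 1 : ℝ) / ((n : ℝ) - 2 * i)) :=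
  prod_nonneg fun i hi => (atten_factor_le_one (by have := mem_range.1 hi; omega)).1

/-- **The spectral tail in `μν` form.** With `|Q| = Pm·N`, `Cn·λ₀ = Pm·N²` (`Pm = |PM| > 0`, `Cn = C(n,t) > 0`) and `Λ = λ₀·A`:
`√(Λ·(sy·sf)) = |Q| · √(A · (sf/Cn) · (sy/Pm))`. [cite: Rothvoss2017, §2 (PDF p. 6)] -/
theorem sqrt_tail_eq {Q l0 Pm N Cn : ℝ} (A sf sy : ℝ) (hPm : 0 < Pm) (hCn : 0 < Cn) (hN : 0 ≤ N)
    (hQ : Q = Pm * N) (hl0 : Cn * l0 = Pm * N ^ 2) :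
    Real.sqrt (l0 * A * (sy * sf)) = Q * Real.sqrt (A * (sf / Cn) * (sy / Pm)) := by
  have hl0' : l0 = Pm * N ^ 2 / Cn := by rw [← hl0]; field_simp
  rw [hl0', hQ]
  have h1 : Pm * N ^ 2 / Cn * A * (sy * sf) = (Pm * N) ^ 2 * (A * (sf / Cn) * (sy / Pm)) := by
    field_simp
  rw [h1, Real.sqrt_mul (by positivity), Real.sqrt_sq (by positivity)]

/-! ### §6 The profile polynomial of a weighted rectangle -/

/-- **The level profile of a weighted rectangle is a polynomial of degree `≤ D` at every odd level, up to `√(P_D μ ν)`.**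
For `n` even, `t = 2c'+1` with `2t + 2 ≤ n`, `D < t`, `f` a function on the `t`-subsets with harmonic layer decomposition `p`
(`f(U) = (Σ_j (Wᵀ)^{t−j} p_j)(U)` for `|U| = t`) and ANY weights `y : PM_n → ℝ`, there is a real polynomial `P` of degree `≤ D` with
`P(0) = (1/|PM_n|)·Σ_M y(M)·Σ_{|A| ≤ D} q_A·knapsackMoment(|M|, t/2, |M[A]|)`, `q = Σ_j (t−j)!·[j ≤ D]·p_j` (the averaged Grigoriev
pseudo-expectation of the low part of `f`), such that for EVERY `m ≤ c'`:
`|Σ_M y(M)·Σ_{|U|=t} f(U)·1[#cr(U,M) = 2m+1] − |Q_{2m+1}(t)|·P(2m+1)| ≤ |Q_{2m+1}(t)|·√(P_D·(Σ_{|U|=t} f(U)²/C(n,t))·(Σ_M y(M)²/|PM_n|))`,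
`P_D = Π_{i < D/2+1} (2i+1)/(n−2i)`. [cite: Rothvoss2017, §2 (PDF p. 6)] [cite: Grigoriev2001, Lemma 1.4 (PDF p. 8)]
[cite: BrouwerHaemers2012, Prop. 4.3.2 (PDF p. 83)] -/
theorem weighted_profile_polynomial {c' D : ℕ} (hn : Even n) (ht : 2 * (2 * c' + 1) + 2 ≤ n) (hD : D ≤ 2 * c')
    (f : Finset (Fin n) → ℝ) (p : ℕ → Finset (Fin n) → ℝ) (hp : ∀ j, IsHarmonic j (p j))
    (hdec : ∀ U ∈ univ.powersetCard (2 * c' + 1), f U = (∑ j ∈ range (2 * c' + 1 + 1), up^[2 * c' + 1 - j] (p j)) U)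
    (y : PMatch n → ℝ) :
    ∃ P : Polynomial ℝ, P.natDegree ≤ D ∧
      P.eval 0 = (Fintype.card (PMatch n) : ℝ)⁻¹ * ∑ M : PMatch n, y M *
        ∑ A : {A : Finset (Fin n) // A.card ≤ D},
          (∑ j ∈ range (2 * c' + 1 + 1), ((2 * c' + 1 - j).factorial : ℝ) • (if D < j then 0 else p j)) A.1 *
            knapsackMoment M.1.card (((2 * c' + 1 : ℕ) : ℝ) / 2) (M.1.filter fun e => ∃ a ∈ A.1, a ∈ e).card ∧
      ∀ m : ℕ, m ≤ c' →
        |∑ M : PMatch n, y M * ∑ U ∈ univ.powersetCard (2 * c' + 1),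
              f U * (if (U.filter fun x => M.2.partner x ∉ U).card = 2 * m + 1 then (1 : ℝ) else 0) -
            ((Qset n (2 * c' + 1) (2 * m + 1)).card : ℝ) * P.eval ((2 * m + 1 : ℕ) : ℝ)| ≤
          ((Qset n (2 * c' + 1) (2 * m + 1)).card : ℝ) *
            Real.sqrt ((∏ i ∈ range (D / 2 + 1), ((2 * i + 1 : ℝ) / ((n : ℝ) - 2 * i))) *
              ((∑ U ∈ univ.powersetCard (2 * c' + 1), f U ^ 2) / (n.choose (2 * c' + 1) : ℝ)) *
              ((∑ M : PMatch n, y M ^ 2) / (Fintype.card (PMatch n) : ℝ))) := by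
  classical
  have htodd : Odd (2 * c' + 1) := ⟨c', rfl⟩
  have htn : 2 * (2 * c' + 1) ≤ n + 1 := by omega
  have ht2 : 2 * (2 * c' + 1) ≤ n := by omega
  set q : Finset (Fin n) → ℝ :=
    ∑ j ∈ range (2 * c' + 1 + 1), ((2 * c' + 1 - j).factorial : ℝ) • (if D < j then 0 else p j) with hq
  obtain ⟨U₀, hU₀⟩ : ∃ U : Finset (Fin n), U ∈ univ.powersetCard (2 * c' + 1) := by
    have : (univ.powersetCard (2 * c' + 1) : Finset (Finset (Fin n))).Nonempty := by
      apply powersetCard_nonempty.2; rw [card_univ, Fintype.card_fin]; omega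
    exact this
  have hq0 : ∀ A : Finset (Fin n), D < A.card → q A = 0 :=
    fun A hA => (lowPart_apply_eq_zeta D p hp (mem_powersetCard.1 hU₀).2).2 A hA
  -- the weighted level polynomial of the low part, normalised by `|PM|`
  obtain ⟨P, hPdeg, hP0, hPval⟩ := exists_weighted_levelPoly_zeta (D := D) htodd y q hq0
  have hPm : (0 : ℝ) < Fintype.card (PMatch n) := by exact_mod_cast card_pmatch_pos hn
  have hCn : (0 : ℝ) < n.choose (2 * c' + 1) := by exact_mod_cast Nat.choose_pos (by omega)
  refine ⟨C ((Fintype.card (PMatch n) : ℝ)⁻¹) * P, (natDegree_C_mul_le _ _).trans hPdeg, ?_, fun m hmc => ?_⟩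
  · rw [eval_mul, eval_C, hP0]
  · -- the Gram class function of the level-`(2m+1)` incidence and its deep spectrum
    obtain ⟨κm, hAm⟩ := exists_levelGram_classFunction (n := n) htodd (2 * m + 1)
    have hl0 := kernelEigen_level_zero_nonneg ht2 κm hAm
    have hPD := prod_atten_nonneg (n := n) (K := D) (by omega)
    have hΛ : ∀ j, D < j → j ≤ 2 * c' + 1 → kernelEigen n (2 * c' + 1) j κm ≤
        kernelEigen n (2 * c' + 1) 0 κm * ∏ i ∈ range (D / 2 + 1), ((2 * i + 1 : ℝ) / ((n : ℝ) - 2 * i)) :=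
      fun j hDj hjt => kernelEigen_level_le_of_lt_sharp hn ht hmc κm hAm hDj hjt
    have hci : 2 * m + 1 + 2 * (c' - m) = 2 * c' + 1 := by omega
    have hmain := weighted_level_sum_sub_poly_le (K := D) htn y f p hp hdec P hPval hci κm hAm
      (mul_nonneg hl0 hPD) hΛ
    -- normalisations `|Q| = |PM|·N`, `C(n,t)·λ₀ = |PM|·N²`
    have hQ := card_Qset_eq (n := n) hmc
    have hlam := kernelEigen_level_zero_eq ht2 hmc κm hAm
    have hNeq : (((n / 2).choose (2 * m + 1 + (c' - m)) * (2 * m + 1 + (c' - m)).choose (c' - m) *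
          2 ^ (2 * m + 1) : ℕ) : ℝ) * P.eval ((2 * m + 1 : ℕ) : ℝ) =
        ((Qset n (2 * c' + 1) (2 * m + 1)).card : ℝ) *
          (C ((Fintype.card (PMatch n) : ℝ)⁻¹) * P).eval ((2 * m + 1 : ℕ) : ℝ) := by
      rw [eval_mul, eval_C, hQ]
      field_simp
    have htail := sqrt_tail_eq (∏ i ∈ range (D / 2 + 1), ((2 * i + 1 : ℝ) / ((n : ℝ) - 2 * i)))
      (∑ U ∈ univ.powersetCard (2 * c' + 1), f U ^ 2) (∑ M : PMatch n, y M ^ 2) hPm hCn (Nat.cast_nonneg _) hQ hlam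
    rw [← hNeq, ← htail]
    exact hmain

end Summit.PneNP.PneNP.Theorems.ChebyshevTracialDesignProfilePolynomial
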